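import Summits.Ventures.WeilGRH.ZetaFlatWindowSpectral
import Summits.Ventures.WeilGRH.FlatWindowArchCostSeries
import Summits.Ventures.WeilGRH.TwistedWindowMeasureGrowth
import Summits.RiemannHypothesis.RiemannHypothesis.Theorems.WeilBochnerMeasureGramEntries
import Summits.RiemannHypothesis.RiemannHypothesis.Theorems.WeilBochnerMeasureCounting
import Literature.NumberTheory.LFunctions.WeilZeroSum
import Literature.NumberTheory.LFunctions.KadiriNumericsBase
import Mathlib.Analysis.Convex.SpecificFunctions.Deriv
import Mathlib.Analysis.Complex.Exponential
import HarnessLib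

/-!
# rh-explicit (venture WeilGRH): LATTICE BLOCKS — one Gram diagonal entry bounds the spectral mass of a
  whole interval around its lattice height; the flat block of the proved rung (weil-3 gen15)

Cell `rh-explicit`, WEIL TRACK (structure seat weil-3, gen15).  Measure level, RH-free unless named.

Let `a > 0` and let `μ` be ANY positive measure representing Weil's form on the tests of `[-a, a]`
(`W(g ⋆ g̃) = ∫ ‖ĝ(½+it)‖² dμ`; such `μ` exist iff `WeilPositivityOn a`, unconditionally for `a ≤ 4023/5000`).
Yoshida's basis function `χ_n = (2a)^{-1/2}e^{iπnx/a}𝟙_{[-a,a]}` has `‖χ̂_n(½+it)‖² = 2a·sinc²(a(t + πn/a))`, and the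
diagonal Gram entry is `G_a(n,n) = ∫ ‖χ̂_n‖² dμ` (`WeilBochnerMeasureGramEntries.gramCoeff_eq_integral`).  Since
`sinc` decreases on `[0, π]` (concavity of `sin`), the Fejér profile is `≥ 2a·(sin x₀/x₀)²` on the block
`|t + πn/a| ≤ x₀/a` (`0 < x₀ ≤ π`).  Hence:

* `mul_sin_le_mul_sin_of_le` (`x sin x₀ ≤ x₀ sin x` on `0 ≤ x ≤ x₀ ≤ π`), `norm_sq_weilMellin_chi_zero_ge_of_abs_le`;
* **`blockMass_le_gramCoeff`** (RH-free, every `a`, `n ∈ ℤ`, `0 < x₀ ≤ π`):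
  `2a·(sin x₀/x₀)²·μ[−πn/a − x₀/a, −πn/a + x₀/a] ≤ G_a(n, n)` — ONE certified Gram diagonal entry bounds the mass
  of a whole interval of length `2x₀/a` (the atom bound of `ZetaGramAtoms` is `x₀ → 0`);
* **`blockMass_le_integral_chi_zero`**, **`flatWindow_integral_frontier_le`** (`∫‖χ̂_0‖²dμ ≤ 0.1684` at
  `a₀ = 4023/5000`, from the flat-window identity of `ZetaFlatWindowSpectral`: pole `16 sinh²(a₀/2)/a₀ ≤ 3.396`, primes
  `2S(a₀) ≥ 1.0565`, `K₀ ≥ 5.3716`, `I₀(a₀) ≤ 4.361 − 4e^{−a₀} ≤ 2.5751`) and **`flatBlock_frontier_le`**: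
  `μ[−41/20, 41/20] ≤ 0.2865` for every Weil measure of the proved rung;
* `measureReal_eq_zero_of_natValued_lt_one` and, for `ν_ζ = Σ_ρ m(ρ)δ_{Im ρ}`,
  **`one_le_zetaZeroHeightMeasure_of_mem`** / **`im_not_mem_of_zetaZeroHeightMeasure_lt_one`**: a set of `ν_ζ`-mass
  `< 1` contains no ordinate of a non-trivial zero (the exclusion principle behind the RH corollaries).

The numerical Gram-diagonal inputs at `n = 1, 2, 3` are `LatticeHeightTrig` + `LatticeArchDiagonalBounds`; the assembly
(every ℕ-valued Weil measure of the rung vanishes on `[−13.71, 13.71]`; RH ⇒ `|Im ρ| > 13.71`) is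
`WeilMeasureEmptyLowHeights`.  No definitions, no named facts, standard axioms.
-/

set_option autoImplicit false

noncomputable section

open Complex Set MeasureTheory
open scoped Real ComplexConjugate ArithmeticFunction.vonMangoldt ENNReal

namespace Summit.Ventures.WeilGRH

open Literature.NumberTheory.LFunctions
open Literature.NumberTheory.LFunctions.Yoshida1992 (chi chiCore gramCoeff)
open Literature.NumberTheory.LFunctions.WeilBochner (zetaZeroHeightMeasure)
open Literature.NumberTheory.LFunctions.ZetaZeros (riemannZetaNontrivialZeros)
open Summit.RiemannHypothesis.RiemannHypothesis.Theorems.WeilFormatC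
open Summit.RiemannHypothesis.RiemannHypothesis.Theorems.WeilBochnerMeasure (gramCoeff_eq_integral
  measure_Icc_lt_top)

variable {a : ℝ}

/-! ## `sinc` decreases on `[0, π]` -/

/-- **Chord below the concave sine**: `x·sin x₀ ≤ x₀·sin x` for `0 ≤ x ≤ x₀ ≤ π` (i.e. `sinc x₀ ≤ sinc x`). -/
theorem mul_sin_le_mul_sin_of_le {x x₀ : ℝ} (hx : 0 ≤ x) (hxx : x ≤ x₀) (hx₀ : x₀ ≤ π) (h0 : 0 < x₀) :
    x * Real.sin x₀ ≤ x₀ * Real.sin x := by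
  have hconc := strictConcaveOn_sin_Icc.concaveOn
  have hθ0 : 0 ≤ x / x₀ := div_nonneg hx h0.le
  have hθ1 : x / x₀ ≤ 1 := div_le_one_of_le₀ hxx h0.le
  have h := hconc.2 (left_mem_Icc.2 Real.pi_pos.le) ⟨h0.le, hx₀⟩ (sub_nonneg.2 hθ1) hθ0 (by ring)
  simp only [smul_eq_mul, Real.sin_zero, mul_zero, zero_add] at h
  rw [show x / x₀ * x₀ = x by field_simp] at h
  calc x * Real.sin x₀ = x₀ * (x / x₀ * Real.sin x₀) := by field_simp
    _ ≤ x₀ * Real.sin x := mul_le_mul_of_nonneg_left h h0.le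

/-- **The Fejér profile on a block**: `2a·(sin x₀/x₀)² ≤ ‖χ̂_0(½+is)‖²` whenever `|s| ≤ x₀/a`, `0 < x₀ ≤ π`
(`‖χ̂_0(½+is)‖² = 2 sin²(as)/(as²) = 2a·sinc²(as)` and `sinc` decreases on `[0, π]`). -/
theorem norm_sq_weilMellin_chi_zero_ge_of_abs_le (ha : 0 < a) {x₀ : ℝ} (hx₀ : 0 < x₀) (hx₀π : x₀ ≤ π)
    {s : ℝ} (hs : |s| ≤ x₀ / a) :
    2 * a * (Real.sin x₀ / x₀) ^ 2 ≤ ‖weilMellin (chi a 0) (1 / 2 + s * I)‖ ^ 2 := by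
  have hsin0 : 0 ≤ Real.sin x₀ := Real.sin_nonneg_of_nonneg_of_le_pi hx₀.le hx₀π
  rcases eq_or_ne s 0 with rfl | hs0
  · rw [norm_sq_weilMellin_chi_zero_zero ha]
    have h1 : (Real.sin x₀ / x₀) ^ 2 ≤ 1 := by
      rw [div_pow, div_le_one (by positivity)]
      have := Real.sin_le hx₀.le
      nlinarith
    nlinarith
  · rw [norm_sq_weilMellin_chi_zero ha hs0]
    set y := a * |s| with hy
    have hspos : 0 < |s| := abs_pos.2 hs0
    have hy0 : 0 < y := by positivity
    have hyx : y ≤ x₀ := by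
      rw [hy]
      calc a * |s| ≤ a * (x₀ / a) := by gcongr
        _ = x₀ := by field_simp
    have hkey := mul_sin_le_mul_sin_of_le hy0.le hyx hx₀π hx₀
    have hsq : Real.sin (a * s) ^ 2 = Real.sin y ^ 2 := by
      rw [hy]
      rcases le_or_gt 0 s with h | h
      · rw [abs_of_nonneg h]
      · rw [abs_of_neg h, mul_neg, Real.sin_neg, neg_sq]
    have h2 : (y * Real.sin x₀) ^ 2 ≤ (x₀ * Real.sin y) ^ 2 :=
      pow_le_pow_left₀ (mul_nonneg hy0.le hsin0) hkey 2
    have hs2 : s ^ 2 = |s| ^ 2 := (sq_abs s).symm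
    rw [hsq, hs2, le_div_iff₀ (by positivity)]
    have hx2 : (0 : ℝ) < x₀ ^ 2 := by positivity
    calc 2 * a * (Real.sin x₀ / x₀) ^ 2 * (a * |s| ^ 2) = 2 * (y * Real.sin x₀) ^ 2 / x₀ ^ 2 := by
          rw [hy]; field_simp
      _ ≤ 2 * (x₀ * Real.sin y) ^ 2 / x₀ ^ 2 := by gcongr
      _ = 2 * Real.sin y ^ 2 := by field_simp

/-! ## One Gram diagonal entry bounds the mass of a block -/

/-- `‖χ̂_n(½ + i(s − πn/a))‖² = ‖χ̂_0(½ + is)‖²`: the `n`-th profile is the flat profile translated by `−πn/a`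
(`χ_n = e^{i(πn/a)x}χ_0` and modulation shifts the transform). -/
theorem norm_sq_weilMellin_chi_shift (a : ℝ) (n : ℤ) (s : ℝ) :
    ‖weilMellin (chi a n) (1 / 2 + ((s - π * n / a : ℝ) : ℂ) * I)‖ ^ 2 =
      ‖weilMellin (chi a 0) (1 / 2 + s * I)‖ ^ 2 := by
  have hchi : chi a n = fun x ↦ cexp (I * ((π * n / a) * x : ℝ)) * chi a 0 x := by
    funext x
    by_cases hx : x ∈ Icc (-a) a
    · rw [chi_apply_of_mem n hx, chi_apply_of_mem 0 hx]
      simp only [Int.cast_zero, mul_zero, zero_mul, zero_div, Complex.exp_zero, mul_one]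
      rw [mul_comm]
      congr 1
      push_cast
      ring_nf
    · rw [chi_apply_of_not_mem n hx, chi_apply_of_not_mem 0 hx, mul_zero]
  rw [hchi, weilMellin_modulate, show s - π * n / a + π * n / a = s by ring]

/-- **`G_a(n,n) = ∫ ‖χ̂_n(½+it)‖² dμ`** (and integrability) for every representing `μ` (polarised `gramCoeff_eq_integral`). -/
theorem integral_norm_sq_weilMellin_chi_eq_gramCoeff (ha : 0 < a) {μ : Measure ℝ}
    (hμ : ∀ g : ℝ → ℂ, IsWeilTest g → tsupport g ⊆ Icc (-a) a →
      Integrable (fun t : ℝ ↦ ‖weilMellin g (1 / 2 + t * I)‖ ^ 2) μ ∧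
        weilQuadratic g = ((∫ t, ‖weilMellin g (1 / 2 + t * I)‖ ^ 2 ∂μ : ℝ) : ℂ)) (n : ℤ) :
    Integrable (fun t : ℝ ↦ ‖weilMellin (chi a n) (1 / 2 + t * I)‖ ^ 2) μ ∧
      ∫ t, ‖weilMellin (chi a n) (1 / 2 + t * I)‖ ^ 2 ∂μ = gramCoeff a n n := by
  obtain ⟨hint, heq⟩ := gramCoeff_eq_integral ha hμ n n
  have hsq : ∀ t : ℝ, (weilMellin (chi a n) (1 / 2 + t * I) * conj (weilMellin (chi a n) (1 / 2 + t * I))).re =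
      ‖weilMellin (chi a n) (1 / 2 + t * I)‖ ^ 2 := fun t ↦ by
    rw [Complex.mul_conj, Complex.ofReal_re, Complex.normSq_eq_norm_sq]
  simp_rw [hsq] at hint heq
  exact ⟨hint, heq.symm⟩

/-- **ONE GRAM DIAGONAL ENTRY BOUNDS THE MASS OF A BLOCK** (RH-free).  For `a > 0`, `n ∈ ℤ`, `0 < x₀ ≤ π` and
every positive `μ` representing Weil's form on the tests of `[-a, a]`:

  `2a·(sin x₀/x₀)²·μ[−πn/a − x₀/a, −πn/a + x₀/a] ≤ G_a(n, n)`. -/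
theorem blockMass_le_gramCoeff (ha : 0 < a) {μ : Measure ℝ}
    (hμ : ∀ g : ℝ → ℂ, IsWeilTest g → tsupport g ⊆ Icc (-a) a →
      Integrable (fun t : ℝ ↦ ‖weilMellin g (1 / 2 + t * I)‖ ^ 2) μ ∧
        weilQuadratic g = ((∫ t, ‖weilMellin g (1 / 2 + t * I)‖ ^ 2 ∂μ : ℝ) : ℂ))
    (n : ℤ) {x₀ : ℝ} (hx₀ : 0 < x₀) (hx₀π : x₀ ≤ π) :
    2 * a * (Real.sin x₀ / x₀) ^ 2 * μ.real (Icc (-(π * n / a) - x₀ / a) (-(π * n / a) + x₀ / a)) ≤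
      gramCoeff a n n := by
  obtain ⟨hint, heq⟩ := integral_norm_sq_weilMellin_chi_eq_gramCoeff ha hμ n
  set B : Set ℝ := Icc (-(π * n / a) - x₀ / a) (-(π * n / a) + x₀ / a) with hB
  set m : ℝ := 2 * a * (Real.sin x₀ / x₀) ^ 2 with hm
  have hBfin : μ B ≠ ⊤ := (measure_Icc_lt_top ha hμ _ _).ne
  have hind : Integrable (B.indicator fun _ ↦ m) μ :=
    (integrable_indicator_iff measurableSet_Icc).2 (integrableOn_const hBfin)
  have hle : ∀ t : ℝ, B.indicator (fun _ ↦ m) t ≤ ‖weilMellin (chi a n) (1 / 2 + t * I)‖ ^ 2 := by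
    intro t
    by_cases ht : t ∈ B
    · rw [indicator_of_mem ht]
      have hs : |t + π * n / a| ≤ x₀ / a := by
        rw [abs_le]; constructor <;> linarith [ht.1, ht.2]
      have h := norm_sq_weilMellin_chi_zero_ge_of_abs_le ha hx₀ hx₀π hs
      rw [← norm_sq_weilMellin_chi_shift a n (t + π * n / a), show t + π * n / a - π * n / a = t by ring] at h
      exact h
    · rw [indicator_of_notMem ht]; positivity
  calc m * μ.real B = ∫ t, B.indicator (fun _ ↦ m) t ∂μ := by
        rw [integral_indicator_const _ measurableSet_Icc, smul_eq_mul, mul_comm]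
    _ ≤ ∫ t, ‖weilMellin (chi a n) (1 / 2 + t * I)‖ ^ 2 ∂μ := integral_mono hind hint hle
    _ = gramCoeff a n n := heq

/-- The flat case `n = 0` through the integral: `2a·(sin x₀/x₀)²·μ[−x₀/a, x₀/a] ≤ ∫ ‖χ̂_0‖² dμ`. -/
theorem blockMass_le_integral_chi_zero (ha : 0 < a) {μ : Measure ℝ}
    (hμ : ∀ g : ℝ → ℂ, IsWeilTest g → tsupport g ⊆ Icc (-a) a →
      Integrable (fun t : ℝ ↦ ‖weilMellin g (1 / 2 + t * I)‖ ^ 2) μ ∧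
        weilQuadratic g = ((∫ t, ‖weilMellin g (1 / 2 + t * I)‖ ^ 2 ∂μ : ℝ) : ℂ))
    {x₀ : ℝ} (hx₀ : 0 < x₀) (hx₀π : x₀ ≤ π) :
    2 * a * (Real.sin x₀ / x₀) ^ 2 * μ.real (Icc (-(x₀ / a)) (x₀ / a)) ≤
      ∫ t, ‖weilMellin (chi a 0) (1 / 2 + t * I)‖ ^ 2 ∂μ := by
  have h := blockMass_le_gramCoeff ha hμ 0 hx₀ hx₀π
  rw [← (integral_norm_sq_weilMellin_chi_eq_gramCoeff ha hμ 0).2] at h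
  simpa using h

/-! ## The flat block of the proved rung `a₀ = 4023/5000` -/

/-- `sinh²(a₀/2) ≤ 0.170773` (`a₀ = 4023/5000`; Taylor enclosures of `e^{±a₀/2}`; true value `0.170767`). -/
theorem sinh_sq_half_frontier_le : Real.sinh (4023 / 5000 / 2) ^ 2 ≤ 0.170773 := by
  rw [Real.sinh_eq]
  have h1 := Real.exp_bound' (x := 4023 / 5000 / 2) (by norm_num) (by norm_num) (n := 6) (by norm_num)
  have h2 := Real.exp_bound (x := -(4023 / 5000 / 2 : ℝ)) (by rw [abs_neg, abs_of_pos (by norm_num)]; norm_num)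
    (n := 6) (by norm_num)
  have h2' := (abs_le.1 h2).1
  simp only [Finset.sum_range_succ, Finset.sum_range_zero, Nat.factorial] at h1 h2'
  norm_num [abs_of_pos] at h1 h2'
  have hmono : Real.exp (-(4023 / 5000 / 2 : ℝ)) ≤ Real.exp (4023 / 5000 / 2) :=
    Real.exp_le_exp.2 (by norm_num)
  nlinarith

/-- `e^{−a₀} ≥ 0.44648` (`a₀ = 4023/5000`; true value `0.447267`). -/
theorem exp_neg_frontier_ge : (0.44648 : ℝ) ≤ Real.exp (-(4023 / 5000)) := by
  have h := Real.exp_bound (x := -(4023 / 5000 : ℝ)) (by rw [abs_neg, abs_of_pos (by norm_num)]; norm_num)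
    (n := 6) (by norm_num)
  have h' := (abs_le.1 h).1
  simp only [Finset.sum_range_succ, Finset.sum_range_zero, Nat.factorial] at h'
  norm_num [abs_of_pos] at h' ⊢
  linarith

/-- **`I₀(a₀) ≤ 2.5751`**: the archimedean cost of the flat window at the frontier
(`I₀(a) = T₀ − Σ_m e^{−2a l_m}/l_m² ≤ 4.361 − 4e^{−a}`; true value `2.5098`). -/
theorem integral_flatArch_frontier_le :
    ∫ t in Ioi (0 : ℝ), weilArchDensityPar 0 t * min t (2 * (4023 / 5000)) ≤ 2.5751 := by
  have hD := hasSum_archConst_sub_integral (a := (4023 / 5000 : ℝ)) 0 (by norm_num)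
  have h0 := le_hasSum hD 0 (fun m _ ↦ by positivity)
  have hT := (archConst_bounds).2.1
  have he := exp_neg_frontier_ge
  norm_num at h0 hT ⊢
  linarith

/-- **`2S(a₀) ≥ 1.0565`**: the flat prime sum `2Σ_{k∈{2,3,4}} Λ(k)k^{-1/2}(1 − log k/(2a₀))` from below. -/
theorem two_mul_flatSum_frontier_ge :
    (1.0565 : ℝ) ≤ 2 * ∑ n ∈ weilPrimeIndex (4023 / 5000 : ℝ), (Λ n : ℝ) / Real.sqrt n *
      (1 - Real.log n / (2 * (4023 / 5000 : ℝ))) := by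
  rw [sum_weilPrimeIndex_eq_threePrime (by have := Real.log_two_lt_d9; linarith)
    (by have := KadiriNumerics.log_5_bounds.1; linarith)]
  push_cast
  have hl1 := Real.log_two_gt_d9; have hl2 := Real.log_two_lt_d9
  obtain ⟨hl3, hl3'⟩ := KadiriNumerics.log_3_bounds
  have hs2' : Real.sqrt 2 ≤ 1.41421357 := by
    have := Real.sqrt_le_sqrt (show (2 : ℝ) ≤ 1.41421357 ^ 2 by norm_num)
    rwa [Real.sqrt_sq (by norm_num)] at this
  have hs3' : Real.sqrt 3 ≤ 1.73205081 := by
    have := Real.sqrt_le_sqrt (show (3 : ℝ) ≤ 1.73205081 ^ 2 by norm_num)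
    rwa [Real.sqrt_sq (by norm_num)] at this
  have hs2pos : (0 : ℝ) < Real.sqrt 2 := Real.sqrt_pos.2 (by norm_num)
  have hs3pos : (0 : ℝ) < Real.sqrt 3 := Real.sqrt_pos.2 (by norm_num)
  have hA2 : (0.490128 : ℝ) ≤ Real.log 2 / Real.sqrt 2 := by rw [le_div_iff₀ hs2pos]; nlinarith
  have hA3 : (0.634284 : ℝ) ≤ Real.log 3 / Real.sqrt 3 := by rw [le_div_iff₀ hs3pos]; nlinarith
  have l4 : Real.log 4 = 2 * Real.log 2 := by
    rw [show (4 : ℝ) = 2 ^ 2 by norm_num, Real.log_pow]; push_cast; ring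
  have hB2 : (0.56925 : ℝ) ≤ 1 - Real.log 2 / (2 * (4023 / 5000)) := by
    have : Real.log 2 / (2 * (4023 / 5000 : ℝ)) ≤ 0.43075 := by rw [div_le_iff₀ (by norm_num)]; linarith
    linarith
  have hB3 : (0.317292 : ℝ) ≤ 1 - Real.log 3 / (2 * (4023 / 5000)) := by
    have : Real.log 3 / (2 * (4023 / 5000 : ℝ)) ≤ 0.682708 := by rw [div_le_iff₀ (by norm_num)]; linarith
    linarith
  have hB4 : (0.138519 : ℝ) ≤ 1 - Real.log 4 / (2 * (4023 / 5000 : ℝ)) := by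
    rw [l4]
    have : 2 * Real.log 2 / (2 * (4023 / 5000 : ℝ)) ≤ 0.861481 := by rw [div_le_iff₀ (by norm_num)]; linarith
    linarith
  nlinarith [mul_le_mul hA2 hB2 (by norm_num) (by positivity), mul_le_mul hA3 hB3 (by norm_num) (by positivity),
    mul_le_mul_of_nonneg_left hB4 (by linarith : (0 : ℝ) ≤ Real.log 2 / 2)]

/-- **THE FLAT WINDOW VALUE OF THE PROVED RUNG FROM ABOVE**: for every positive `μ` representing Weil's form on
`[-a₀, a₀]`, `a₀ = 4023/5000`: `∫ ‖χ̂_0(½+it)‖² dμ ≤ 0.1684` (true value `0.0834`; the flat-window identity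
`∫‖χ̂_0‖²dμ = 16 sinh²(a₀/2)/a₀ − 2S(a₀) − K₀ + I₀(a₀)/a₀` of `ZetaFlatWindowSpectral`). -/
theorem flatWindow_integral_frontier_le {μ : Measure ℝ}
    (hμ : ∀ g : ℝ → ℂ, IsWeilTest g → tsupport g ⊆ Icc (-(4023 / 5000 : ℝ)) (4023 / 5000) →
      Integrable (fun t : ℝ ↦ ‖weilMellin g (1 / 2 + t * I)‖ ^ 2) μ ∧
        weilQuadratic g = ((∫ t, ‖weilMellin g (1 / 2 + t * I)‖ ^ 2 ∂μ : ℝ) : ℂ)) :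
    ∫ t, ‖weilMellin (chi (4023 / 5000) 0) (1 / 2 + t * I)‖ ^ 2 ∂μ ≤ 0.1684 := by
  have ha : (0 : ℝ) < 4023 / 5000 := by norm_num
  obtain ⟨-, heq⟩ := zetaFlatWindow_eq_pole_sub_integral ha hμ
  have hK := flatWindow_const_zero_ge
  have hI := integral_flatArch_frontier_le
  have hsh := sinh_sq_half_frontier_le
  have hS := two_mul_flatSum_frontier_ge
  have hpole : 16 * Real.sinh (4023 / 5000 / 2) ^ 2 / (4023 / 5000) ≤ 3.39594 := by
    rw [div_le_iff₀ ha]; nlinarith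
  have hIa : 1 / (4023 / 5000 : ℝ) * ∫ t in Ioi (0 : ℝ), weilArchDensityPar 0 t * min t (2 * (4023 / 5000)) ≤
      3.20048 := by
    rw [one_div_mul_eq_div, div_le_iff₀ ha]; nlinarith
  linarith

/-- **THE FLAT BLOCK**: every positive `μ` representing Weil's form on `[-a₀, a₀]` has `μ[−41/20, 41/20] ≤ 0.2865`
(`x₀ = 41a₀/20 = 1.649`, `2a₀(sin x₀/x₀)² ≥ 0.5878`; `ν_ζ`: `0`). -/
theorem flatBlock_frontier_le {μ : Measure ℝ}
    (hμ : ∀ g : ℝ → ℂ, IsWeilTest g → tsupport g ⊆ Icc (-(4023 / 5000 : ℝ)) (4023 / 5000) →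
      Integrable (fun t : ℝ ↦ ‖weilMellin g (1 / 2 + t * I)‖ ^ 2) μ ∧
        weilQuadratic g = ((∫ t, ‖weilMellin g (1 / 2 + t * I)‖ ^ 2 ∂μ : ℝ) : ℂ)) :
    μ.real (Icc (-(41 / 20 : ℝ)) (41 / 20)) ≤ 0.2865 := by
  have ha : (0 : ℝ) < 4023 / 5000 := by norm_num
  have hπ1 := Real.pi_gt_d20; have hπ2 := Real.pi_lt_d20
  -- `x₀ = a₀ · 41/20 = 164943/100000 ∈ (π/2, π)`; `sin x₀ = cos(x₀ − π/2) ≥ 1 − (x₀ − π/2)²/2 ≥ 0.9969`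
  have hx₀ : (0 : ℝ) < 164943 / 100000 := by norm_num
  have hx₀π : (164943 / 100000 : ℝ) ≤ π := by linarith
  have h := blockMass_le_integral_chi_zero ha hμ hx₀ hx₀π
  have hW := flatWindow_integral_frontier_le hμ
  have e : (164943 / 100000 : ℝ) / (4023 / 5000) = 41 / 20 := by norm_num
  rw [e] at h
  have hsin : (0.9969 : ℝ) ≤ Real.sin (164943 / 100000) := by
    rw [← Real.cos_sub_pi_div_two]
    have hc := Real.one_sub_sq_div_two_le_cos (x := 164943 / 100000 - π / 2)
    nlinarith
  have hm : (0.5878 : ℝ) ≤ 2 * (4023 / 5000) * (Real.sin (164943 / 100000) / (164943 / 100000)) ^ 2 := by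
    rw [div_pow]
    have : (0.9969 : ℝ) ^ 2 ≤ Real.sin (164943 / 100000) ^ 2 := pow_le_pow_left₀ (by norm_num) hsin 2
    rw [show 2 * (4023 / 5000 : ℝ) * (Real.sin (164943 / 100000) ^ 2 / (164943 / 100000) ^ 2) =
      2 * (4023 / 5000) / (164943 / 100000) ^ 2 * Real.sin (164943 / 100000) ^ 2 by ring]
    nlinarith
  have hμ0 : 0 ≤ μ.real (Icc (-(41 / 20 : ℝ)) (41 / 20)) := measureReal_nonneg
  nlinarith

/-! ## ℕ-valued masses below one vanish; a set of `ν_ζ`-mass `< 1` holds no zero -/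

/-- An ℕ-valued mass `< 1` is `0`. -/
theorem measureReal_eq_zero_of_natValued_lt_one {μ : Measure ℝ} {S : Set ℝ} (hN : ∃ k : ℕ, μ.real S = k)
    (h1 : μ.real S < 1) : μ.real S = 0 := by
  obtain ⟨k, hk⟩ := hN
  rw [hk] at h1 ⊢
  have : k < 1 := by exact_mod_cast h1
  simp [Nat.lt_one_iff.1 this]

/-- An ℕ-valued mass `< 1` of a set of finite measure is `0` (as an `ℝ≥0∞` measure). -/
theorem measure_eq_zero_of_natValued_lt_one {μ : Measure ℝ} {S : Set ℝ} (hfin : μ S ≠ ⊤)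
    (hN : ∃ k : ℕ, μ.real S = k) (h1 : μ.real S < 1) : μ S = 0 := by
  have h := measureReal_eq_zero_of_natValued_lt_one hN h1
  rw [measureReal_def, ENNReal.toReal_eq_zero_iff] at h
  exact h.resolve_right hfin

/-- **`ν_ζ(S) ≥ 1` if `S` contains the ordinate of a non-trivial zero** (`ν_ζ = Σ_ρ m(ρ)δ_{Im ρ}`, `m(ρ) ≥ 1`);
unconditional. -/
theorem one_le_zetaZeroHeightMeasure_of_mem {ρ : ℂ} (hρ : ρ ∈ riemannZetaNontrivialZeros) {S : Set ℝ}
    (hS : ρ.im ∈ S) : 1 ≤ zetaZeroHeightMeasure S := by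
  have hle : ((riemannZetaZeroOrder ρ).toNat : ℝ≥0∞) • Measure.dirac ρ.im ≤ zetaZeroHeightMeasure := by
    rw [zetaZeroHeightMeasure]
    exact Measure.le_sum (fun ρ : riemannZetaNontrivialZeros ↦
      ((riemannZetaZeroOrder (ρ : ℂ)).toNat : ℝ≥0∞) • Measure.dirac (ρ : ℂ).im) ⟨ρ, hρ⟩
  have h1 : (1 : ℝ≥0∞) ≤ ((riemannZetaZeroOrder ρ).toNat : ℝ≥0∞) := by
    have h := ZetaZeros.riemannZetaNontrivialZeros.one_le_order hρ
    have : 1 ≤ (riemannZetaZeroOrder ρ).toNat := by omega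
    exact_mod_cast this
  have h2 : (1 : ℝ≥0∞) ≤ Measure.dirac ρ.im S := by
    have h := Measure.le_dirac_apply (a := ρ.im) (s := S)
    rwa [indicator_of_mem hS, Pi.one_apply] at h
  calc (1 : ℝ≥0∞) = 1 * 1 := (one_mul 1).symm
    _ ≤ ((riemannZetaZeroOrder ρ).toNat : ℝ≥0∞) * Measure.dirac ρ.im S := mul_le_mul' h1 h2
    _ = (((riemannZetaZeroOrder ρ).toNat : ℝ≥0∞) • Measure.dirac ρ.im) S := by
        rw [Measure.smul_apply, smul_eq_mul]
    _ ≤ zetaZeroHeightMeasure S := Measure.le_iff'.1 hle S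

/-- **THE EXCLUSION PRINCIPLE**: a set of finite `ν_ζ`-mass `< 1` contains the ordinate of NO non-trivial zero of `ζ`. -/
theorem im_not_mem_of_zetaZeroHeightMeasure_lt_one {S : Set ℝ} (hfin : zetaZeroHeightMeasure S ≠ ⊤)
    (hlt : zetaZeroHeightMeasure.real S < 1) {ρ : ℂ} (hρ : ρ ∈ riemannZetaNontrivialZeros) : ρ.im ∉ S := by
  intro hS
  have h1 := one_le_zetaZeroHeightMeasure_of_mem hρ hS
  have h2 : (1 : ℝ) ≤ zetaZeroHeightMeasure.real S := by
    rw [measureReal_def]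
    have := ENNReal.toReal_mono hfin h1
    rwa [ENNReal.toReal_one] at this
  linarith

end Summit.Ventures.WeilGRH

end
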